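import Literature.Computability.QuantumComplexity.EvenSVTDegreeBookkeeping
import Mathlib.Analysis.Calculus.MeanValue
import HarnessLib

/-!
# Odd polynomial singular value transformation from `SQ_φ(A)`: the explicit degree
# bookkeeping (CGLLTW 2022, Theorem 3.4 odd case, via Lemma "low-deg-lipschitz", odd half),
# Frobenius form

Chia, Gilyén, Li, Lin, Tang, Wang, *Sampling-based sublinear low-rank matrix arithmetic framework
for dequantizing quantum machine learning*, J. ACM 69(5):33 (2022) = arXiv:1910.06151, §3.3
"Dequantizing QSVT": Theorem 3.4, ODD case (held arXiv text p. 20 L6: "if `p` is odd, meaning that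
we can express `p(x) = x·q(x²)` … then `p^{(SV)}(A) := A·q(A†A)`"; p. 21 L40–46: "Now for the odd
case … we take `g(x)` to be `q(x) − q(0)` in `[-1,1]` and held constant outside it, so
`p^{(SV)}(A) = A·g(A†A)` [+ `q(0)A`] … we get `R, C` such that
`‖R†ḡ(CC†)R + g(0)I − g(A†A)‖ < ε/‖A‖` … where `r = Õ(d⁶‖A‖⁴‖A‖_F²ε⁻²δ⁻¹)`,
`c = Õ(d¹⁰‖A‖⁸‖A‖_F²ε⁻²δ⁻¹)`") and Lemma "low-deg-lipschitz", odd half (p. 20 L58: "If `p` is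
odd, then `max|q(x)| ≲ d`, `max|q'(x)| ≲ d³`, `max|q̄(x)| ≲ d³`, and `max|q̄'(x)| ≲ d⁵`").

This module is the odd-parity companion of `EvenSVTDegreeBookkeeping` (the even case,
`even_polynomial_svt`: thresholds `s ≍ φ²d⁴‖A‖_F⁴ℓ/ε²`, `c ≍ φ⁶d⁸‖A‖_F⁸ℓ/ε²`).  The whole odd
case reduces to the even machinery plus ONE scalar input:

* `abs_eval_le_mul_abs` — if `p(0) = 0`, `deg p ≤ d` and `|p| ≤ 1` on `[-1,1]`, then
  `|p(x)| ≤ 2d·|x|` on `[-1,1]` (Bernstein's inequality in the bulk `|x| ≤ ½`, where the slope of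
  `p` is at most `2d/√3`, and the trivial `1 ≤ 2d|x|` outside it; the Chebyshev polynomial `T_d`,
  `d` odd, has `T_d'(0) = ±d`, so the truth is `d` and the constant `2` is the only slack);
* `abs_eval_le_of_odd_bound` — hence for an odd polynomial `p(x) = x·q(x²)` of degree
  `d = 2k+1` bounded by `1` on `[-1,1]`: `|q| ≤ 2d` on `[0,1]` (the printed `max|q| ≲ d`);
* `abs_eval_sub_eval_le_odd`, `abs_eval_divX_le_odd`, `abs_eval_divX_sub_le_odd` — the other
  three odd bounds of the Lemma with explicit constants `d³`, `d³`, `d⁵`, from the even module's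
  `M`-general Markov lemmas at `M = 2d`;
* `polynomial_svt_of_sup_bound` — the even module's `even_polynomial_svt` with a general sup
  bound `|q| ≤ M` on `[0,1]` (thresholds × `M²`): `s ≥ 8φ²(2k)⁴M²‖A‖_F⁴ℓ/ε²`,
  `c ≥ 8φ⁶(2k)⁸M²‖A‖_F⁸ℓ/ε²`;
* `odd_polynomial_svt_core`, **`odd_polynomial_svt`** — CGLLTW Theorem 3.4, odd case, at the
  MATRIX level: for `q` with `deg q ≤ k` and `|x·q(x²)| ≤ 1` on `[-1,1]` (`d = 2k+1`), under
  `s ≥ 32φ²d⁶‖A‖_F⁴log(6/δ)/ε²`, `s ≥ 2φ²log(3/δ)`, `c ≥ 32φ⁶d¹⁰‖A‖_F⁸log(6/δ)/ε²` — the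
  printed `r ≍ d⁶`, `c ≍ d¹⁰` with constants — the two-stage sketch satisfies
  `‖A·(Rᵀq̄_clamp(CCᵀ)R + q(0)I) − A·q(AᵀA)‖_F ≤ ‖A‖_F·ε` with mass `> 1 − δ`, where
  `A·q(AᵀA) = p^{(SV)}(A)` is the printed DEFINITION of the odd singular value transformation;
  `odd_polynomial_svt_normalised` — the print's normalisation `‖A‖_F ≤ 1`;
* `odd_threshold_product_display` — at these thresholds `s²c = 2¹⁵φ¹⁰d²²‖A‖_F¹⁶ℓ³/ε⁶`:
  degree exponent `22`, the printed odd `Õ(d²²…)`.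

HONEST FRAMING.  A MATRIX-level Frobenius-norm guarantee for a classical sketching procedure
under sample-and-query access, with explicit polynomial dependence on the degree, in the host
theorem's Frobenius currency: the print's operator-norm step `‖A·E‖ ≤ ‖A‖‖E‖` is relaxed to
`‖A·E‖_F ≤ ‖A‖_F‖E‖_F` (`sqrt_frobSq_mul_le`); the vector step of Theorem 3.4 (`u ≈ Rb`, the three
approximate matrix products, `SQ_φ(v)`) and running times are NOT typed.  Nothing in this file
bears on `BQP` vs `BPP`; no sampler is implemented.  All statements are theorems; no named
facts; standard axioms.
-/

noncomputable section

open scoped Matrix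
open Polynomial Finset

namespace Literature.Computability.QuantumComplexity

namespace SampleQuery

namespace OddPolySVT

open EvenPolySVT

/-! ### §1 Lemma "low-deg-lipschitz", odd half: the one new scalar input and its corollaries -/

/-- **Bernstein in the bulk.** If `deg p ≤ d` and `|p| ≤ 1` on `[-1,1]` then `|p'(x)| ≤ 2d/√3`
for `|x| ≤ ½` (the tree's `bernstein_inequality` `|p'(x)|√(1−x²) ≤ d` with `√(1−x²) ≥ √3/2`).
[folklore] -/
private theorem abs_derivative_le_of_bulk {d : ℕ} {p : ℝ[X]} (hp : p.degree ≤ d)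
    (h1 : ∀ y ∈ Set.Icc (-1 : ℝ) 1, |p.eval y| ≤ 1) {x : ℝ}
    (hx : x ∈ Set.Icc (-(1 / 2) : ℝ) (1 / 2)) :
    |(derivative p).eval x| ≤ 2 * d / Real.sqrt 3 := by
  have hx1 : x ∈ Set.Icc (-1 : ℝ) 1 := ⟨by linarith [hx.1], by linarith [hx.2]⟩
  have hB := Literature.Analysis.Approximation.bernstein_inequality hp h1 hx1
  -- `√(1 - x²) ≥ √3/2` on the bulk
  have hsq : (3 : ℝ) / 4 ≤ 1 - x ^ 2 := by nlinarith [hx.1, hx.2]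
  have hroot : Real.sqrt 3 / 2 ≤ Real.sqrt (1 - x ^ 2) := by
    have : Real.sqrt 3 / 2 = Real.sqrt (3 / 4) := by
      rw [Real.sqrt_div (by norm_num : (0:ℝ) ≤ 3), show Real.sqrt 4 = 2 by
        rw [show (4:ℝ) = 2 ^ 2 by norm_num, Real.sqrt_sq (by norm_num : (0:ℝ) ≤ 2)]]
    rw [this]
    exact Real.sqrt_le_sqrt hsq
  have h3 : 0 < Real.sqrt 3 := Real.sqrt_pos.mpr (by norm_num)
  have hpos : 0 < Real.sqrt 3 / 2 := by positivity
  have habs : 0 ≤ |(derivative p).eval x| := abs_nonneg _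
  -- |p'| · (√3/2) ≤ |p'| · √(1-x²) ≤ d
  have hle : |(derivative p).eval x| * (Real.sqrt 3 / 2) ≤ d * 1 :=
    (mul_le_mul_of_nonneg_left hroot habs).trans hB
  rw [le_div_iff₀ h3]
  nlinarith [hle]

/-- **The one new scalar input (`max|p(x)/x| ≲ d`).**  If `p(0) = 0`, `deg p ≤ d` and `|p| ≤ 1`
on `[-1,1]`, then `|p(x)| ≤ 2d·|x|` for every `x ∈ [-1,1]`: on the bulk `|x| ≤ ½` by the mean
value inequality with the Bernstein slope `2d/√3 ≤ 2d`; for `|x| ≥ ½` trivially `|p(x)| ≤ 1 ≤ 2d|x|`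
(`d ≥ 1`; for `d = 0`, `p = 0`).  The odd Chebyshev polynomials (`T_d'(0) = ±d`) show that `d`
is the true order. [cite: ChiaEtAl2022, §3.3 Lemma "low-deg-lipschitz" (odd case,
`max_{x∈[-1,1]}|q(x)| ≲ d` for `p(x) = x·q(x²)`; "These bounds are tight for Chebyshev
polynomials")] -/
theorem abs_eval_le_mul_abs {d : ℕ} {p : ℝ[X]} (hp : p.natDegree ≤ d) (h0 : p.eval 0 = 0)
    (h1 : ∀ y ∈ Set.Icc (-1 : ℝ) 1, |p.eval y| ≤ 1) {x : ℝ} (hx : x ∈ Set.Icc (-1 : ℝ) 1) :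
    |p.eval x| ≤ 2 * d * |x| := by
  rcases Nat.eq_zero_or_pos d with rfl | hd
  · -- `d = 0`: `p` is the constant `p(0) = 0`
    have hc : p = C (p.coeff 0) := eq_C_of_natDegree_le_zero hp
    have : p.eval x = p.eval 0 := by rw [hc]; simp
    rw [this, h0]; simp
  have hd1 : (1 : ℝ) ≤ d := by exact_mod_cast hd
  by_cases hbulk : |x| ≤ 1 / 2
  · -- bulk: mean value inequality on `[-½, ½]` with slope `2d/√3`
    have hdeg : p.degree ≤ d := degree_le_of_natDegree_le hp
    have hderiv : ∀ z ∈ Set.Icc (-(1 / 2) : ℝ) (1 / 2),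
        ‖deriv (fun t => p.eval t) z‖ ≤ 2 * d / Real.sqrt 3 := by
      intro z hz
      rw [Polynomial.deriv, Real.norm_eq_abs]
      exact abs_derivative_le_of_bulk hdeg h1 hz
    have hx' : x ∈ Set.Icc (-(1 / 2) : ℝ) (1 / 2) := ⟨by linarith [(abs_le.mp hbulk).1],
      (abs_le.mp hbulk).2⟩
    have h0' : (0 : ℝ) ∈ Set.Icc (-(1 / 2) : ℝ) (1 / 2) := ⟨by norm_num, by norm_num⟩
    have hmv := (convex_Icc (-(1 / 2) : ℝ) (1 / 2)).norm_image_sub_le_of_norm_deriv_le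
      (fun z _ => p.differentiableAt) hderiv h0' hx'
    simp only [h0, sub_zero, Real.norm_eq_abs] at hmv
    have h3 : (1 : ℝ) ≤ Real.sqrt 3 := by
      rw [show (1:ℝ) = Real.sqrt 1 by simp]; exact Real.sqrt_le_sqrt (by norm_num)
    have h3pos : 0 < Real.sqrt 3 := by positivity
    have hslope : 2 * (d : ℝ) / Real.sqrt 3 ≤ 2 * d := by
      rw [div_le_iff₀ h3pos]; nlinarith
    exact hmv.trans (mul_le_mul_of_nonneg_right hslope (abs_nonneg x))
  · -- edge: `|p(x)| ≤ 1 ≤ 2d|x|`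
    have hx2 : 1 / 2 < |x| := lt_of_not_ge hbulk
    calc |p.eval x| ≤ 1 := h1 x hx
      _ ≤ 2 * d * |x| := by nlinarith

/-- The odd polynomial `x·q(x²)` attached to `q`, as a polynomial: `X · q(X²)`. [folklore] -/
private theorem eval_oddPoly (q : ℝ[X]) (x : ℝ) :
    (X * q.comp (X ^ 2)).eval x = x * q.eval (x ^ 2) := by
  simp [eval_comp]

/-- `deg (X · q(X²)) ≤ 2k + 1` when `deg q ≤ k`. [folklore] -/
private theorem natDegree_oddPoly_le {k : ℕ} {q : ℝ[X]} (hq : q.natDegree ≤ k) :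
    (X * q.comp (X ^ 2)).natDegree ≤ 2 * k + 1 := by
  calc (X * q.comp (X ^ 2)).natDegree ≤ (X : ℝ[X]).natDegree + (q.comp (X ^ 2)).natDegree :=
        natDegree_mul_le
    _ ≤ 1 + 2 * k := by
        gcongr
        · exact natDegree_X_le
        · calc (q.comp (X ^ 2)).natDegree ≤ q.natDegree * (X ^ 2 : ℝ[X]).natDegree :=
              natDegree_comp_le
            _ ≤ k * 2 := by
                gcongr
                exact (natDegree_pow_le).trans (by simp)
            _ = 2 * k := by ring
    _ = 2 * k + 1 := by ring

/-- `(X · q(X²))'(0) = q(0)`. [folklore] -/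
private theorem derivative_oddPoly_eval_zero (q : ℝ[X]) :
    (derivative (X * q.comp (X ^ 2))).eval 0 = q.eval 0 := by
  simp [derivative_mul, derivative_comp, eval_comp]

/-- **Odd half of the Lemma, first bound (`max|q| ≲ d`), explicit.**  If `deg q ≤ k` and the odd
polynomial `p(x) = x·q(x²)` (degree `d = 2k+1`) satisfies `|p| ≤ 1` on `[-1,1]`, then
`|q(y)| ≤ 2d = 2(2k+1)` for every `y ∈ [0,1]` (`q(y) = p(√y)/√y` for `y > 0`, and
`q(0) = p'(0)`). [cite: ChiaEtAl2022, §3.3 Lemma "low-deg-lipschitz" (odd case,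
`max|q(x)| ≲ d`)] -/
theorem abs_eval_le_of_odd_bound {k : ℕ} {q : ℝ[X]} (hq : q.natDegree ≤ k)
    (hq1 : ∀ x ∈ Set.Icc (-1 : ℝ) 1, |x * q.eval (x ^ 2)| ≤ 1) {y : ℝ}
    (hy : y ∈ Set.Icc (0 : ℝ) 1) : |q.eval y| ≤ 2 * (2 * k + 1) := by
  set p : ℝ[X] := X * q.comp (X ^ 2) with hpdef
  have hp : p.natDegree ≤ 2 * k + 1 := natDegree_oddPoly_le hq
  have h1 : ∀ x ∈ Set.Icc (-1 : ℝ) 1, |p.eval x| ≤ 1 := fun x hx => by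
    rw [hpdef, eval_oddPoly]; exact hq1 x hx
  have h0 : p.eval 0 = 0 := by rw [hpdef, eval_oddPoly]; simp
  rcases eq_or_lt_of_le hy.1 with h0y | hpos
  · -- `y = 0`: `q(0) = p'(0)`, Bernstein at `0`
    subst h0y
    have hdeg : p.degree ≤ (2 * k + 1 : ℕ) := degree_le_of_natDegree_le hp
    have hB := abs_derivative_le_of_bulk hdeg h1 (x := 0) ⟨by norm_num, by norm_num⟩
    rw [hpdef, derivative_oddPoly_eval_zero] at hB
    have h3 : (1 : ℝ) ≤ Real.sqrt 3 := by
      rw [show (1:ℝ) = Real.sqrt 1 by simp]; exact Real.sqrt_le_sqrt (by norm_num)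
    have h3pos : 0 < Real.sqrt 3 := by positivity
    have hk : (0 : ℝ) ≤ 2 * k + 1 := by positivity
    calc |q.eval 0| ≤ 2 * ((2 * k + 1 : ℕ) : ℝ) / Real.sqrt 3 := hB
      _ ≤ 2 * (2 * k + 1) := by
          rw [div_le_iff₀ h3pos]; push_cast; nlinarith
  · -- `y > 0`: `x = √y`, `|x·q(y)| ≤ 2d·x`
    set x : ℝ := Real.sqrt y with hxdef
    have hx0 : 0 < x := Real.sqrt_pos.mpr hpos
    have hx1 : x ∈ Set.Icc (-1 : ℝ) 1 :=
      ⟨by linarith [hx0.le], by rw [hxdef, ← Real.sqrt_one]; exact Real.sqrt_le_sqrt hy.2⟩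
    have hxy : x ^ 2 = y := by rw [hxdef, Real.sq_sqrt hy.1]
    have key := abs_eval_le_mul_abs hp h0 h1 hx1
    rw [hpdef, eval_oddPoly, hxy, abs_mul, abs_of_pos hx0] at key
    -- `x · |q y| ≤ 2d · x`
    have : |q.eval y| * x ≤ 2 * (2 * k + 1) * x := by
      calc |q.eval y| * x = x * |q.eval y| := by ring
        _ ≤ 2 * ((2 * k + 1 : ℕ) : ℝ) * x := key
        _ = 2 * (2 * k + 1) * x := by push_cast; ring
    exact le_of_mul_le_mul_right this hx0

/-- **Odd half, second bound (`max|q'| ≲ d³`) as a Lipschitz constant on `[0,1]`:**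
`|q(x) − q(y)| ≤ d³|x − y|`, `d = 2k+1` (Markov on `[0,1]`: `2k²·2d = 4k²d ≤ d³`).
[cite: ChiaEtAl2022, §3.3 Lemma "low-deg-lipschitz" (odd case, `max|q'(x)| ≲ d³`)] -/
theorem abs_eval_sub_eval_le_odd {k : ℕ} {q : ℝ[X]} (hq : q.natDegree ≤ k)
    (hq1 : ∀ x ∈ Set.Icc (-1 : ℝ) 1, |x * q.eval (x ^ 2)| ≤ 1) {x y : ℝ}
    (hx : x ∈ Set.Icc (0 : ℝ) 1) (hy : y ∈ Set.Icc (0 : ℝ) 1) :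
    |q.eval x - q.eval y| ≤ (2 * k + 1) ^ 3 * |x - y| := by
  have h := abs_eval_sub_eval_le hq (fun z hz => abs_eval_le_of_odd_bound hq hq1 hz) hx hy
  refine h.trans (mul_le_mul_of_nonneg_right ?_ (abs_nonneg _))
  have hk : (0 : ℝ) ≤ k := Nat.cast_nonneg k
  nlinarith [sq_nonneg (k : ℝ), mul_nonneg hk (sq_nonneg (k : ℝ))]

/-- **Odd half, third bound (`max|q̄| ≲ d³`):** `|q̄(y)| ≤ d³` on `[0,1]`, `q̄ = (q − q(0))/X`
(`divX q`), `d = 2k+1`. [cite: ChiaEtAl2022, §3.3 Lemma "low-deg-lipschitz" (odd case,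
`max|q̄(x)| ≲ d³`)] -/
theorem abs_eval_divX_le_odd {k : ℕ} {q : ℝ[X]} (hq : q.natDegree ≤ k)
    (hq1 : ∀ x ∈ Set.Icc (-1 : ℝ) 1, |x * q.eval (x ^ 2)| ≤ 1) {y : ℝ}
    (hy : y ∈ Set.Icc (0 : ℝ) 1) : |(divX q).eval y| ≤ (2 * k + 1) ^ 3 := by
  have h := abs_eval_divX_le hq (fun z hz => abs_eval_le_of_odd_bound hq hq1 hz) hy
  refine h.trans ?_
  have hk : (0 : ℝ) ≤ k := Nat.cast_nonneg k
  nlinarith [sq_nonneg (k : ℝ), mul_nonneg hk (sq_nonneg (k : ℝ))]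

/-- **Odd half, fourth bound (`max|q̄'| ≲ d⁵`) as a Lipschitz constant on `[0,1]`:**
`|q̄(x) − q̄(y)| ≤ d⁵|x − y|`, `d = 2k+1` (`4k⁴·2d = 8k⁴d ≤ d⁵/2`).
[cite: ChiaEtAl2022, §3.3 Lemma "low-deg-lipschitz" (odd case, `max|q̄'(x)| ≲ d⁵`)] -/
theorem abs_eval_divX_sub_le_odd {k : ℕ} {q : ℝ[X]} (hq : q.natDegree ≤ k)
    (hq1 : ∀ x ∈ Set.Icc (-1 : ℝ) 1, |x * q.eval (x ^ 2)| ≤ 1) {x y : ℝ}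
    (hx : x ∈ Set.Icc (0 : ℝ) 1) (hy : y ∈ Set.Icc (0 : ℝ) 1) :
    |(divX q).eval x - (divX q).eval y| ≤ (2 * k + 1) ^ 5 * |x - y| := by
  have h := abs_eval_divX_sub_le hq (fun z hz => abs_eval_le_of_odd_bound hq hq1 hz) hx hy
  refine h.trans (mul_le_mul_of_nonneg_right ?_ (abs_nonneg _))
  have hk : (0 : ℝ) ≤ k := Nat.cast_nonneg k
  have hk2 : (0 : ℝ) ≤ (k : ℝ) ^ 2 := sq_nonneg _
  have hk3 : (0 : ℝ) ≤ (k : ℝ) ^ 3 := by positivity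
  have hk4 : (0 : ℝ) ≤ (k : ℝ) ^ 4 := by positivity
  nlinarith [mul_nonneg hk hk4, mul_nonneg hk2 hk2, mul_nonneg hk hk3]

/-! ### §2 The even machinery at a general sup bound `M` (thresholds × `M²`) -/

variable {m n s c : ℕ} {φ : ℝ} {A : Matrix (Fin m) (Fin n) ℝ}

/-- **`spec(AᵀA) ⊆ (−∞, ‖A‖_F²]`** (every eigenvalue of the Gram matrix is at most its trace).
[folklore] -/
private theorem spectrum_gram_le_frobSq (A : Matrix (Fin m) (Fin n) ℝ) {x : ℝ}
    (hx : x ∈ spectrum ℝ (Aᵀ * A)) : x ≤ frobSq A := by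
  classical
  have hP : (Aᵀ * A).PosSemidef := by
    simpa [Matrix.conjTranspose_eq_transpose_of_trivial] using
      Matrix.posSemidef_conjTranspose_mul_self A
  have hH : (Aᵀ * A).IsHermitian := hP.1
  rw [hH.spectrum_real_eq_range_eigenvalues] at hx
  obtain ⟨i, rfl⟩ := hx
  have hnn : ∀ j, 0 ≤ hH.eigenvalues j := hP.eigenvalues_nonneg
  have htr : (Aᵀ * A).trace = ∑ j, hH.eigenvalues j := by
    have h := hH.trace_eq_sum_eigenvalues
    simpa using h
  have htr' : (Aᵀ * A).trace = frobSq A := by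
    simp only [Matrix.trace, Matrix.diag_apply, Matrix.mul_apply, Matrix.transpose_apply,
      frobSq_eq_sum_sq, pow_two]
    exact Finset.sum_comm
  calc hH.eigenvalues i ≤ ∑ j, hH.eigenvalues j :=
        Finset.single_le_sum (fun j _ => hnn j) (Finset.mem_univ i)
    _ = frobSq A := by rw [← htr, htr']

/-- **Two-stage mass is monotone in the event** (nonnegative weights). [folklore] -/
private theorem mass_mono {ι κ : Type*} [Fintype ι] (v : Finset κ) (w : ι → ℝ)
    (w' : ι → κ → ℝ) (hw : ∀ i, 0 ≤ w i) (hw' : ∀ i j, 0 ≤ w' i j) (P Q : ι → κ → Prop)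
    [∀ i, DecidablePred (P i)] [∀ i, DecidablePred (Q i)] (hPQ : ∀ i j, P i j → Q i j) :
    ∑ i, w i * ∑ j ∈ v.filter (P i), w' i j ≤ ∑ i, w i * ∑ j ∈ v.filter (Q i), w' i j := by
  refine Finset.sum_le_sum fun i _ => mul_le_mul_of_nonneg_left ?_ (hw i)
  refine Finset.sum_le_sum_of_subset_of_nonneg (fun j hj => ?_) (fun j _ _ => hw' i j)
  rw [Finset.mem_filter] at hj ⊢
  exact ⟨hj.1, hPQ i j hj.2⟩

/-- **Polynomial singular value transformation of `AᵀA` at a general sup bound** (the even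
module's `even_polynomial_svt` with `|q| ≤ M` on `[0,1]` in place of `|q| ≤ 1`; thresholds scale by
`M²`).  Let `SQ_φ(A)` be given (`A ≠ 0`, `spec(AᵀA) ⊆ [0,1]`), `deg q ≤ k`, `|q| ≤ M` on `[0,1]`,
`δ ∈ (0,1]`, `ε > 0`, `s ≥ 8φ²(2k)⁴M²‖A‖_F⁴log(6/δ)/ε²`, `s ≥ 2φ²log(3/δ)`,
`c ≥ 8φ⁶(2k)⁸M²‖A‖_F⁸log(6/δ)/ε²`.  Then the two-stage mass of
`‖Rᵀ·q̄_clamp(CCᵀ)·R + q(0)I − q(AᵀA)‖_F ≤ ε` exceeds `1 − δ` — the host theorem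
`even_singular_value_transformation_sample_complexity` at `f = qClamp q` (`L = 2k²M`),
`f̄ = qbarClamp q` (`L̄ = 4k⁴M`). [cite: ChiaEtAl2022, §3.3 Theorem 3.4 with Lemma
"low-deg-lipschitz" (the proof's `r`, `c` in terms of the Lipschitz constants `L`, `L̄`, held
arXiv text p. 20 L65 – p. 21 L8)] -/
theorem polynomial_svt_of_sup_bound (W : MatrixOversamplingWitness φ A) (hA : A ≠ 0)
    (hA1 : ∀ x ∈ spectrum ℝ (Aᵀ * A), x ≤ 1) (hs : 0 < s) (hc : 0 < c) {δ ε : ℝ}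
    (hδ : 0 < δ) (hδ1 : δ ≤ 1) (hε : 0 < ε) {k : ℕ} (q : ℝ[X]) (hq : q.natDegree ≤ k) {M : ℝ}
    (hqM : ∀ y ∈ Set.Icc (0 : ℝ) 1, |q.eval y| ≤ M)
    (hsL : 8 * φ ^ 2 * (2 * k) ^ 4 * M ^ 2 * frobSq A ^ 2 * Real.log (6 / δ) / ε ^ 2 ≤ s)
    (hs3 : 2 * φ ^ 2 * Real.log (3 / δ) ≤ s)
    (hcL : 8 * φ ^ 6 * (2 * k) ^ 8 * M ^ 2 * frobSq A ^ 4 * Real.log (6 / δ) / ε ^ 2 ≤ c) :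
    1 - δ <
      ∑ ω : Fin s → Fin m, iidWeight (rowDist W.tilde) ω *
        ∑ τ ∈ univ.filter (fun τ : Fin c → Fin n =>
          Real.sqrt (frobSq ((sketch (rowDist W.tilde) ω * A)ᵀ *
              cfc (qbarClamp q) ((sketch (rowDist (sketch (rowDist W.tilde) ω * W.tilde)ᵀ) τ *
                  (sketch (rowDist W.tilde) ω * A)ᵀ)ᵀ *
                (sketch (rowDist (sketch (rowDist W.tilde) ω * W.tilde)ᵀ) τ *
                  (sketch (rowDist W.tilde) ω * A)ᵀ)) *
              (sketch (rowDist W.tilde) ω * A) + (q.eval 0) • (1 : Matrix (Fin n) (Fin n) ℝ) -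
              aeval (Aᵀ * A) q)) ≤ ε),
          iidWeight (rowDist (sketch (rowDist W.tilde) ω * W.tilde)ᵀ) τ := by
  classical
  have hM0 : 0 ≤ M := (abs_nonneg _).trans (hqM 0 ⟨le_rfl, zero_le_one⟩)
  have hL0 : (0 : ℝ) ≤ 2 * (k : ℝ) ^ 2 * M := by positivity
  have hLb0 : (0 : ℝ) ≤ 4 * (k : ℝ) ^ 4 * M := by positivity
  have hL : ∀ x y : ℝ, 0 ≤ x → 0 ≤ y →
      |qClamp q x - qClamp q y| ≤ 2 * (k : ℝ) ^ 2 * M * |x - y| :=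
    fun x y hx hy => abs_qClamp_sub_le hq hqM hx hy
  have hLb : ∀ x y : ℝ, 0 ≤ x → 0 ≤ y →
      |qbarClamp q x - qbarClamp q y| ≤ 4 * (k : ℝ) ^ 4 * M * |x - y| :=
    fun x y _ _ => abs_qbarClamp_sub_le hq hqM x y
  have hff : ∀ x : ℝ, 0 ≤ x → x * qbarClamp q x = qClamp q x := fun x _ => rfl
  have hsL' : 32 * φ ^ 2 * (2 * (k : ℝ) ^ 2 * M) ^ 2 * frobSq A ^ 2 * Real.log (6 / δ) / ε ^ 2
      ≤ s := by
    have : 32 * φ ^ 2 * (2 * (k : ℝ) ^ 2 * M) ^ 2 * frobSq A ^ 2 * Real.log (6 / δ) / ε ^ 2 =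
        8 * φ ^ 2 * (2 * k) ^ 4 * M ^ 2 * frobSq A ^ 2 * Real.log (6 / δ) / ε ^ 2 := by ring
    rw [this]; exact hsL
  have hcL' : 128 * φ ^ 6 * (4 * (k : ℝ) ^ 4 * M) ^ 2 * frobSq A ^ 4 * Real.log (6 / δ) / ε ^ 2
      ≤ c := by
    have : 128 * φ ^ 6 * (4 * (k : ℝ) ^ 4 * M) ^ 2 * frobSq A ^ 4 * Real.log (6 / δ) / ε ^ 2 =
        8 * φ ^ 6 * (2 * k) ^ 8 * M ^ 2 * frobSq A ^ 4 * Real.log (6 / δ) / ε ^ 2 := by ring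
    rw [this]; exact hcL
  have key := even_singular_value_transformation_sample_complexity W hA hs hc hδ hδ1 hε
    (qClamp q) (qbarClamp q) hL0 hL hLb0 hLb hff hsL' hs3 hcL'
  have hId := cfc_qClamp_gram_eq q hA1 (A := A)
  simp_rw [hId, sub_sub_eq_add_sub] at key
  exact key

/-! ### §3 Theorem 3.4, odd case, at the matrix level -/

/-- **Odd case, core (the transformed Gram part).**  Let `SQ_φ(A)` be given (`A ≠ 0`,
`spec(AᵀA) ⊆ [0,1]`), `deg q ≤ k` with the ODD polynomial `p(x) = x·q(x²)` of degree `d = 2k+1`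
bounded by `1` on `[-1,1]`, `δ ∈ (0,1]`, `ε > 0`, and
`s ≥ 32φ²d⁶‖A‖_F⁴log(6/δ)/ε²`, `s ≥ 2φ²log(3/δ)`, `c ≥ 32φ⁶d¹⁰‖A‖_F⁸log(6/δ)/ε²`.
Then the two-stage mass of `‖Rᵀ·q̄_clamp(CCᵀ)·R + q(0)I − q(AᵀA)‖_F ≤ ε` exceeds `1 − δ`
(`polynomial_svt_of_sup_bound` at `M = 2d`, `abs_eval_le_of_odd_bound`; `(2k)⁴(2d)² ≤ 4d⁶`,
`(2k)⁸(2d)² ≤ 4d¹⁰`) — the printed `r = Õ(d⁶‖A‖⁴‖A‖_F²ε⁻²log(1/δ))`,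
`c = Õ(d¹⁰‖A‖⁸‖A‖_F²ε⁻²log(1/δ))` with constants, in the host's Frobenius currency.
[cite: ChiaEtAl2022, §3.3 Theorem 3.4 (odd case: "we get `R, C` such that
`‖R†ḡ(CC†)R + g(0)I − g(A†A)‖ < ε/‖A‖` … where `r = Õ(d⁶…)`, `c = Õ(d¹⁰…)`", held arXiv text
p. 21 L40–46)] -/
theorem odd_polynomial_svt_core (W : MatrixOversamplingWitness φ A) (hA : A ≠ 0)
    (hA1 : ∀ x ∈ spectrum ℝ (Aᵀ * A), x ≤ 1) (hs : 0 < s) (hc : 0 < c) {δ ε : ℝ}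
    (hδ : 0 < δ) (hδ1 : δ ≤ 1) (hε : 0 < ε) {k : ℕ} (q : ℝ[X]) (hq : q.natDegree ≤ k)
    (hq1 : ∀ x ∈ Set.Icc (-1 : ℝ) 1, |x * q.eval (x ^ 2)| ≤ 1)
    (hsL : 32 * φ ^ 2 * (2 * k + 1) ^ 6 * frobSq A ^ 2 * Real.log (6 / δ) / ε ^ 2 ≤ s)
    (hs3 : 2 * φ ^ 2 * Real.log (3 / δ) ≤ s)
    (hcL : 32 * φ ^ 6 * (2 * k + 1) ^ 10 * frobSq A ^ 4 * Real.log (6 / δ) / ε ^ 2 ≤ c) :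
    1 - δ <
      ∑ ω : Fin s → Fin m, iidWeight (rowDist W.tilde) ω *
        ∑ τ ∈ univ.filter (fun τ : Fin c → Fin n =>
          Real.sqrt (frobSq ((sketch (rowDist W.tilde) ω * A)ᵀ *
              cfc (qbarClamp q) ((sketch (rowDist (sketch (rowDist W.tilde) ω * W.tilde)ᵀ) τ *
                  (sketch (rowDist W.tilde) ω * A)ᵀ)ᵀ *
                (sketch (rowDist (sketch (rowDist W.tilde) ω * W.tilde)ᵀ) τ *
                  (sketch (rowDist W.tilde) ω * A)ᵀ)) *
              (sketch (rowDist W.tilde) ω * A) + (q.eval 0) • (1 : Matrix (Fin n) (Fin n) ℝ) -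
              aeval (Aᵀ * A) q)) ≤ ε),
          iidWeight (rowDist (sketch (rowDist W.tilde) ω * W.tilde)ᵀ) τ := by
  have hM : ∀ y ∈ Set.Icc (0 : ℝ) 1, |q.eval y| ≤ 2 * (2 * k + 1) :=
    fun y hy => abs_eval_le_of_odd_bound hq hq1 hy
  have hℓ : 0 ≤ Real.log (6 / δ) := Real.log_nonneg (by rw [le_div_iff₀ hδ]; linarith)
  have hF : 0 ≤ frobSq A := frobSq_nonneg A
  have hk : (0 : ℝ) ≤ k := Nat.cast_nonneg k
  have hk4 : (2 * (k : ℝ)) ^ 4 ≤ (2 * k + 1) ^ 4 :=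
    pow_le_pow_left₀ (by positivity) (by linarith) 4
  have hk8 : (2 * (k : ℝ)) ^ 8 ≤ (2 * k + 1) ^ 8 :=
    pow_le_pow_left₀ (by positivity) (by linarith) 8
  refine polynomial_svt_of_sup_bound W hA hA1 hs hc hδ hδ1 hε q hq hM (le_trans ?_ hsL) hs3
    (le_trans ?_ hcL)
  · calc 8 * φ ^ 2 * (2 * (k : ℝ)) ^ 4 * (2 * (2 * k + 1)) ^ 2 * frobSq A ^ 2 *
          Real.log (6 / δ) / ε ^ 2
        = 32 * ((2 * (k : ℝ)) ^ 4 * (2 * k + 1) ^ 2) * (φ ^ 2 * frobSq A ^ 2 *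
          Real.log (6 / δ) / ε ^ 2) := by ring
      _ ≤ 32 * ((2 * (k : ℝ) + 1) ^ 4 * (2 * k + 1) ^ 2) * (φ ^ 2 * frobSq A ^ 2 *
          Real.log (6 / δ) / ε ^ 2) := by gcongr
      _ = 32 * φ ^ 2 * (2 * k + 1) ^ 6 * frobSq A ^ 2 * Real.log (6 / δ) / ε ^ 2 := by ring
  · calc 8 * φ ^ 6 * (2 * (k : ℝ)) ^ 8 * (2 * (2 * k + 1)) ^ 2 * frobSq A ^ 4 *
          Real.log (6 / δ) / ε ^ 2
        = 32 * ((2 * (k : ℝ)) ^ 8 * (2 * k + 1) ^ 2) * ((φ ^ 2) ^ 3 * frobSq A ^ 4 *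
          Real.log (6 / δ) / ε ^ 2) := by ring
      _ ≤ 32 * ((2 * (k : ℝ) + 1) ^ 8 * (2 * k + 1) ^ 2) * ((φ ^ 2) ^ 3 * frobSq A ^ 4 *
          Real.log (6 / δ) / ε ^ 2) := by gcongr
      _ = 32 * φ ^ 6 * (2 * k + 1) ^ 10 * frobSq A ^ 4 * Real.log (6 / δ) / ε ^ 2 := by ring

/-- **Theorem (odd polynomial singular value transformation, explicit degree dependence;
CGLLTW Thm 3.4 odd case at the matrix level, Frobenius form).**  With the hypotheses of
`odd_polynomial_svt_core` (`p(x) = x·q(x²)` odd of degree `d = 2k+1`, `|p| ≤ 1` on `[-1,1]`;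
`s ≥ 32φ²d⁶‖A‖_F⁴log(6/δ)/ε²`, `s ≥ 2φ²log(3/δ)`, `c ≥ 32φ⁶d¹⁰‖A‖_F⁸log(6/δ)/ε²`), the
two-stage mass of
`‖A·(Rᵀ·q̄_clamp(CCᵀ)·R + q(0)I) − A·q(AᵀA)‖_F ≤ ‖A‖_F·ε`
exceeds `1 − δ`, where `A·q(AᵀA) = p^{(SV)}(A)` is the printed definition of the odd singular value
transformation and `‖A·E‖_F ≤ ‖A‖_F‖E‖_F` (`sqrt_frobSq_mul_le`) is the Frobenius relaxation of
the print's `‖A·E‖ ≤ ‖A‖·‖E‖`.  The vector step (`u ≈ Rb`, the three approximate matrix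
products, `SQ_φ(v)`) is not typed. [cite: ChiaEtAl2022, §3.3 Theorem 3.4 (odd case,
`p^{(SV)}(A) := A·q(A†A)`, held arXiv text p. 20 L6; proof p. 21 L40–46 with `r ≍ d⁶`,
`c ≍ d¹⁰`)] -/
theorem odd_polynomial_svt (W : MatrixOversamplingWitness φ A) (hA : A ≠ 0)
    (hA1 : ∀ x ∈ spectrum ℝ (Aᵀ * A), x ≤ 1) (hs : 0 < s) (hc : 0 < c) {δ ε : ℝ}
    (hδ : 0 < δ) (hδ1 : δ ≤ 1) (hε : 0 < ε) {k : ℕ} (q : ℝ[X]) (hq : q.natDegree ≤ k)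
    (hq1 : ∀ x ∈ Set.Icc (-1 : ℝ) 1, |x * q.eval (x ^ 2)| ≤ 1)
    (hsL : 32 * φ ^ 2 * (2 * k + 1) ^ 6 * frobSq A ^ 2 * Real.log (6 / δ) / ε ^ 2 ≤ s)
    (hs3 : 2 * φ ^ 2 * Real.log (3 / δ) ≤ s)
    (hcL : 32 * φ ^ 6 * (2 * k + 1) ^ 10 * frobSq A ^ 4 * Real.log (6 / δ) / ε ^ 2 ≤ c) :
    1 - δ <
      ∑ ω : Fin s → Fin m, iidWeight (rowDist W.tilde) ω *
        ∑ τ ∈ univ.filter (fun τ : Fin c → Fin n =>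
          Real.sqrt (frobSq (A * ((sketch (rowDist W.tilde) ω * A)ᵀ *
              cfc (qbarClamp q) ((sketch (rowDist (sketch (rowDist W.tilde) ω * W.tilde)ᵀ) τ *
                  (sketch (rowDist W.tilde) ω * A)ᵀ)ᵀ *
                (sketch (rowDist (sketch (rowDist W.tilde) ω * W.tilde)ᵀ) τ *
                  (sketch (rowDist W.tilde) ω * A)ᵀ)) *
              (sketch (rowDist W.tilde) ω * A) + (q.eval 0) • (1 : Matrix (Fin n) (Fin n) ℝ)) -
              A * aeval (Aᵀ * A) q)) ≤ Real.sqrt (frobSq A) * ε),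
          iidWeight (rowDist (sketch (rowDist W.tilde) ω * W.tilde)ᵀ) τ := by
  classical
  refine lt_of_lt_of_le (odd_polynomial_svt_core W hA hA1 hs hc hδ hδ1 hε q hq hq1 hsL hs3 hcL)
    (mass_mono _ _ _ (iidWeight_nonneg (W.isOversampledDist_rowDist hA).nonneg)
      (fun ω τ => iidWeight_nonneg (fun _ => div_nonneg (normSq_nonneg _) (frobSq_nonneg _)) τ)
      _ _ fun ω τ h => ?_)
  rw [← Matrix.mul_sub]
  exact (sqrt_frobSq_mul_le _ _).trans (mul_le_mul_of_nonneg_left h (Real.sqrt_nonneg _))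

/-- **Corollary (the print's normalisation `‖A‖_F ≤ 1`).**  Under `‖A‖_F² ≤ 1` the spectral
hypothesis is automatic and the thresholds read `s ≥ 32φ²d⁶log(6/δ)/ε²`, `s ≥ 2φ²log(3/δ)`,
`c ≥ 32φ⁶d¹⁰log(6/δ)/ε²` (`d = 2k+1`), with the event `‖A·(…) − A·q(AᵀA)‖_F ≤ ε`: the printed
odd `r ≍ d⁶`, `c ≍ d¹⁰`, hence `r²c ≍ d²²`, with constants. [cite: ChiaEtAl2022, §3.3 Theorem 3.4
(odd case: "`‖A‖_F = 1`", runtime `Õ(d²²…)`)] -/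
theorem odd_polynomial_svt_normalised (W : MatrixOversamplingWitness φ A) (hA : A ≠ 0)
    (hF : frobSq A ≤ 1) (hs : 0 < s) (hc : 0 < c) {δ ε : ℝ}
    (hδ : 0 < δ) (hδ1 : δ ≤ 1) (hε : 0 < ε) {k : ℕ} (q : ℝ[X]) (hq : q.natDegree ≤ k)
    (hq1 : ∀ x ∈ Set.Icc (-1 : ℝ) 1, |x * q.eval (x ^ 2)| ≤ 1)
    (hsL : 32 * φ ^ 2 * (2 * k + 1) ^ 6 * Real.log (6 / δ) / ε ^ 2 ≤ s)
    (hs3 : 2 * φ ^ 2 * Real.log (3 / δ) ≤ s)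
    (hcL : 32 * φ ^ 6 * (2 * k + 1) ^ 10 * Real.log (6 / δ) / ε ^ 2 ≤ c) :
    1 - δ <
      ∑ ω : Fin s → Fin m, iidWeight (rowDist W.tilde) ω *
        ∑ τ ∈ univ.filter (fun τ : Fin c → Fin n =>
          Real.sqrt (frobSq (A * ((sketch (rowDist W.tilde) ω * A)ᵀ *
              cfc (qbarClamp q) ((sketch (rowDist (sketch (rowDist W.tilde) ω * W.tilde)ᵀ) τ *
                  (sketch (rowDist W.tilde) ω * A)ᵀ)ᵀ *
                (sketch (rowDist (sketch (rowDist W.tilde) ω * W.tilde)ᵀ) τ *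
                  (sketch (rowDist W.tilde) ω * A)ᵀ)) *
              (sketch (rowDist W.tilde) ω * A) + (q.eval 0) • (1 : Matrix (Fin n) (Fin n) ℝ)) -
              A * aeval (Aᵀ * A) q)) ≤ ε),
          iidWeight (rowDist (sketch (rowDist W.tilde) ω * W.tilde)ᵀ) τ := by
  classical
  have hF0 : 0 ≤ frobSq A := frobSq_nonneg A
  have hℓ : 0 ≤ Real.log (6 / δ) := Real.log_nonneg (by rw [le_div_iff₀ hδ]; linarith)
  have hφ : 0 < φ := W.pos hA
  have hF2 : frobSq A ^ 2 ≤ 1 := pow_le_one₀ hF0 hF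
  have hF4 : frobSq A ^ 4 ≤ 1 := pow_le_one₀ hF0 hF
  have hsqF : Real.sqrt (frobSq A) ≤ 1 := Real.sqrt_le_one.mpr hF
  have hA1 : ∀ x ∈ spectrum ℝ (Aᵀ * A), x ≤ 1 :=
    fun x hx => (spectrum_gram_le_frobSq A hx).trans hF
  have hsL' : 32 * φ ^ 2 * (2 * k + 1) ^ 6 * frobSq A ^ 2 * Real.log (6 / δ) / ε ^ 2 ≤ s := by
    refine le_trans ?_ hsL
    have h0 : 0 ≤ 32 * φ ^ 2 * (2 * (k : ℝ) + 1) ^ 6 * Real.log (6 / δ) / ε ^ 2 := by positivity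
    calc 32 * φ ^ 2 * (2 * (k : ℝ) + 1) ^ 6 * frobSq A ^ 2 * Real.log (6 / δ) / ε ^ 2
        = 32 * φ ^ 2 * (2 * (k : ℝ) + 1) ^ 6 * Real.log (6 / δ) / ε ^ 2 * frobSq A ^ 2 := by ring
      _ ≤ 32 * φ ^ 2 * (2 * (k : ℝ) + 1) ^ 6 * Real.log (6 / δ) / ε ^ 2 :=
          mul_le_of_le_one_right h0 hF2
  have hcL' : 32 * φ ^ 6 * (2 * k + 1) ^ 10 * frobSq A ^ 4 * Real.log (6 / δ) / ε ^ 2 ≤ c := by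
    refine le_trans ?_ hcL
    have h0 : 0 ≤ 32 * φ ^ 6 * (2 * (k : ℝ) + 1) ^ 10 * Real.log (6 / δ) / ε ^ 2 := by positivity
    calc 32 * φ ^ 6 * (2 * (k : ℝ) + 1) ^ 10 * frobSq A ^ 4 * Real.log (6 / δ) / ε ^ 2
        = 32 * φ ^ 6 * (2 * (k : ℝ) + 1) ^ 10 * Real.log (6 / δ) / ε ^ 2 * frobSq A ^ 4 := by ring
      _ ≤ 32 * φ ^ 6 * (2 * (k : ℝ) + 1) ^ 10 * Real.log (6 / δ) / ε ^ 2 :=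
          mul_le_of_le_one_right h0 hF4
  refine lt_of_lt_of_le (odd_polynomial_svt W hA hA1 hs hc hδ hδ1 hε q hq hq1 hsL' hs3 hcL')
    (mass_mono _ _ _ (iidWeight_nonneg (W.isOversampledDist_rowDist hA).nonneg)
      (fun ω τ => iidWeight_nonneg (fun _ => div_nonneg (normSq_nonneg _) (frobSq_nonneg _)) τ)
      _ _ fun ω τ h => ?_)
  exact h.trans (by simpa using mul_le_mul_of_nonneg_right hsqF hε.le)

/-! ### §4 The displayed exponent -/

/-- **Display (degree exponent 22).**  At the thresholds of `odd_polynomial_svt`,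
`s = 32φ²d⁶F²ℓ/ε²` and `c = 32φ⁶d¹⁰F⁴ℓ/ε²` (`F = ‖A‖_F²`, `ℓ = log(6/δ)`), the printed dominant
cost `r²c` reads `s²c = 2¹⁵ φ¹⁰ d²² F⁸ ℓ³ / ε⁶` — degree exponent `22`, matching the print's odd
`Õ(d²²‖A‖¹⁶/(ε‖p(A)b‖)⁶·log³(1/δ))` (there `‖A‖_F = 1`; operator norms relaxed to
`φ‖A‖_F²`-powers here).  An arithmetic identity recording the printed cost model; no algorithm
is modelled. [cite: ChiaEtAl2022, §3.3 Theorem 3.4 (odd runtime display `Õ(d²²…)`, held arXiv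
text p. 20 L21–30)] -/
theorem odd_threshold_product_display (φ d F ℓ ε : ℝ) (hε : ε ≠ 0) :
    (32 * φ ^ 2 * d ^ 6 * F ^ 2 * ℓ / ε ^ 2) ^ 2 * (32 * φ ^ 6 * d ^ 10 * F ^ 4 * ℓ / ε ^ 2) =
      2 ^ 15 * φ ^ 10 * d ^ 22 * F ^ 8 * ℓ ^ 3 / ε ^ 6 := by
  field_simp
  ring

end OddPolySVT

end SampleQuery

end Literature.Computability.QuantumComplexity
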